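import Mathlib
import HarnessLib
import Literature.MathematicalPhysics.StatisticalMechanics.ComplexGradientStiffness
import Summits.HubbardSuperconductivity.HubbardSuperconductivity.Theorems.ComplexGFFStiffnessDefs
import Summits.HubbardSuperconductivity.HubbardSuperconductivity.Theorems.ComplexGFFStiffnessHypACumulantPertZBasic
import Summits.HubbardSuperconductivity.HubbardSuperconductivity.Theorems.ComplexGFFStiffnessHypALocalTwoPointOnePointDerivative

/-!
# Crux `HypALocalTwoPoint`, line `gnv` — the derivative of the partition function along
# `s ↦ K + s·G·(1+K)` for observables of Gaussian growth `exp(|z|²/8)`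

Route `route-HubbardSuperconductivity-ComplexGFFStiffness`, crux item stmt-HubbardSuperconductivity-19155.
`…OnePointDerivative.hasDerivAt_pertZ_linePert` treats BOUNDED observables `G` (enough for the cosine
two-point function); `OnePointLipschitz` quantifies over observables in the weighted class
`IsIotaAdmissibleWt r₀ (1/8) 1` (`‖G(z)‖ ≤ e^{|z|²/8}`, e.g. the quadratic tilt response of the sibling
crux).  This file proves the same derivative formula in that generality: for continuous `K`, `G` with
`‖K(z)‖ ≤ ρ e^{Σz_i²/8}`, `‖G(z)‖ ≤ B e^{Σz_i²/8}`, the dominating function is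
`|Λ| B ((1+ρ)(1+B))^{|Λ|} · e^{−S_0(φ)/2}` (two weights `e^{|∇φ|²/8}` per site against
`Σ_x |∇φ(x)|² ≤ 2 S_0(φ)`).

* `hasDerivAt_pertZ_linePert_growth`, `hasDerivAt_pertZ_linePert_div_growth`,
  `norm_onePoint_sub_le_of_ratio_bound_growth` — census (C1)/(C2) of the line memo for the full
  observable class of `OnePointLipschitz`.

## References
* S. Adams, S. Buchholz, R. Kotecký, S. Müller, arXiv:1910.13564, Sec. 2.1, Theorem 2.2
  [AdamsBuchholzKoteckyMuller2019].
-/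

noncomputable section

-- `Summit.<Summit>.<Problem>`: single-conjunct summit, the duplicate component is mandated (D-0017).
set_option linter.dupNamespace false

namespace Summit.HubbardSuperconductivity.HubbardSuperconductivity.Theorems.ComplexGFF

open scoped BigOperators ComplexConjugate Topology
open MeasureTheory Filter
open Literature.MathematicalPhysics.StatisticalMechanics.ComplexGradientGFF4 (Z ev D S w)

variable {n : ℕ}

/-- elementary: `‖1 + c·a‖ ≤ (1 + B)·e^{g}` when `‖c‖ ≤ 1`, `‖a‖ ≤ B e^{g}`, `g ≥ 0`. -/
theorem norm_one_add_mul_le_weight {c a : ℂ} {B g : ℝ} (hc : ‖c‖ ≤ 1) (hg : 0 ≤ g)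
    (ha : ‖a‖ ≤ B * Real.exp g) : ‖1 + c * a‖ ≤ (1 + B) * Real.exp g := by
  have he : 1 ≤ Real.exp g := Real.one_le_exp hg
  calc ‖1 + c * a‖ ≤ ‖(1 : ℂ)‖ + ‖c * a‖ := norm_add_le _ _
    _ = 1 + ‖c‖ * ‖a‖ := by rw [norm_one, norm_mul]
    _ ≤ 1 + 1 * (B * Real.exp g) := by
        have := mul_le_mul hc ha (norm_nonneg _) zero_le_one
        linarith
    _ ≤ (1 + B) * Real.exp g := by nlinarith

/-- the Gaussian weights of all sites against the action: `2 Σ_x (Σ_i (∂_iφ(x))²/8) ≤ S_0(φ)/2`, so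
`e^{−S_0(φ)} · (e^{Σ_x |∇φ(x)|²/8})² ≤ e^{−S_0(φ)/2}`. -/
theorem exp_neg_S_mul_weights_le [NeZero n] (φ : (Fin 4 → ZMod n) → ℝ) :
    Real.exp (-(S 0 φ)) * (Real.exp (∑ x : Fin 4 → ZMod n, (1 / 8) * ∑ i : Fin 4, (D φ i x) ^ 2)) ^ 2
      ≤ Real.exp (-(S 0 φ) / 2) := by
  rw [← Real.exp_nat_mul, ← Real.exp_add]
  refine Real.exp_le_exp.mpr ?_
  have h := sum_sq_D_le_two_S φ
  rw [← Finset.mul_sum]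
  push_cast
  linarith

/-- **(C1) for observables of Gaussian growth.**  For continuous `K`, `G` with
`‖K(z)‖ ≤ ρ e^{Σ z_i²/8}` and `‖G(z)‖ ≤ B e^{Σ z_i²/8}`, the map `s ↦ pertZ n (K + s·G·(1+K))` has
derivative `∫ (Σ_x G(∇φ(x))) e^{−S_0}∏(1+K) dφ` at `s = 0`. -/
theorem hasDerivAt_pertZ_linePert_growth [NeZero n] {K G : (Fin 4 → ℝ) → ℂ} (hKc : Continuous K)
    {ρ : ℝ} (hρ : 0 ≤ ρ) (hKb : ∀ z : Fin 4 → ℝ, ‖K z‖ ≤ ρ * Real.exp (1 / 8 * ∑ i : Fin 4, (z i) ^ 2))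
    (hGc : Continuous G) {B : ℝ} (hB : 0 ≤ B)
    (hGb : ∀ z : Fin 4 → ℝ, ‖G z‖ ≤ B * Real.exp (1 / 8 * ∑ i : Fin 4, (z i) ^ 2)) :
    HasDerivAt (fun s : ℝ => pertZ n (fun z => K z + (s : ℂ) * (G z * (1 + K z))))
      (∫ φ : (Fin 4 → ZMod n) → ℝ, (∑ x : Fin 4 → ZMod n, G (fun i => D φ i x)) *
        (Complex.exp (-((S 0 φ : ℝ) : ℂ)) * ∏ x : Fin 4 → ZMod n, (1 + K (fun i => D φ i x)))) 0 := by
  -- notation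
  set W : ((Fin 4 → ZMod n) → ℝ) → ℂ := fun φ =>
    Complex.exp (-((S 0 φ : ℝ) : ℂ)) * ∏ x : Fin 4 → ZMod n, (1 + K (fun i => D φ i x)) with hWdef
  set Gx : ((Fin 4 → ZMod n) → ℝ) → (Fin 4 → ZMod n) → ℂ := fun φ x => G (fun i => D φ i x) with hGxdef
  set g : ((Fin 4 → ZMod n) → ℝ) → (Fin 4 → ZMod n) → ℝ := fun φ x => (1 / 8) * ∑ i : Fin 4, (D φ i x) ^ 2
    with hgdef
  have hg0 : ∀ φ x, 0 ≤ g φ x := fun φ x => by rw [hgdef]; positivity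
  have hKb4 : ∀ z : Fin 4 → ℝ, ‖K z‖ ≤ ρ * Real.exp ((∑ i : Fin 4, (z i) ^ 2) / 4) := fun z =>
    (hKb z).trans (mul_le_mul_of_nonneg_left (Real.exp_le_exp.mpr (by
      have h0 : 0 ≤ ∑ i : Fin 4, (z i) ^ 2 := Finset.sum_nonneg (fun i _ => sq_nonneg _)
      linarith)) hρ)
  have hWint : Integrable W := integrable_pertZ_integrand n hKc hρ hKb4
  have hWc : Continuous W := continuous_weight hKc
  have hGxc : ∀ x, Continuous (fun φ : (Fin 4 → ZMod n) → ℝ => Gx φ x) :=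
    fun x => hGc.comp (continuous_gradVec x)
  -- the family and its derivative
  set F : ℝ → ((Fin 4 → ZMod n) → ℝ) → ℂ := fun s φ =>
    W φ * ∏ x : Fin 4 → ZMod n, (1 + (s : ℂ) * Gx φ x) with hFdef
  set F' : ℝ → ((Fin 4 → ZMod n) → ℝ) → ℂ := fun s φ =>
    W φ * ∑ x : Fin 4 → ZMod n,
      (∏ y ∈ (Finset.univ : Finset (Fin 4 → ZMod n)).erase x, (1 + (s : ℂ) * Gx φ y)) • Gx φ x
    with hF'def
  have hfun : (fun s : ℝ => pertZ n (fun z => K z + (s : ℂ) * (G z * (1 + K z))))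
      = fun s => ∫ φ, F s φ := by
    funext s
    unfold pertZ
    refine integral_congr_ae (Eventually.of_forall (fun φ => ?_))
    simp only [hFdef, hWdef, hGxdef]
    rw [prod_one_add_linePert, mul_assoc]
  rw [hfun]
  have hval : (∫ φ : (Fin 4 → ZMod n) → ℝ, (∑ x : Fin 4 → ZMod n, G (fun i => D φ i x)) *
        (Complex.exp (-((S 0 φ : ℝ) : ℂ)) * ∏ x : Fin 4 → ZMod n, (1 + K (fun i => D φ i x))))
      = ∫ φ, F' 0 φ := by
    refine integral_congr_ae (Eventually.of_forall (fun φ => ?_))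
    simp only [hF'def, hWdef, hGxdef, Complex.ofReal_zero, zero_mul, add_zero,
      Finset.prod_const_one, one_smul]
    ring
  rw [hval]
  have hball : Metric.ball (0 : ℝ) 1 ∈ 𝓝 (0 : ℝ) := Metric.ball_mem_nhds 0 one_pos
  have hprodc : ∀ s : ℝ, Continuous (fun φ : (Fin 4 → ZMod n) → ℝ =>
      ∏ x : Fin 4 → ZMod n, (1 + (s : ℂ) * Gx φ x)) := fun s =>
    continuous_finsetProd _ (fun x _ => continuous_const.add (continuous_const.mul (hGxc x)))
  have hF_meas : ∀ s : ℝ, AEStronglyMeasurable (F s) volume := fun s =>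
    (hWc.mul (hprodc s)).aestronglyMeasurable
  have hF_int : Integrable (F 0) := by
    refine (hWint.congr (Eventually.of_forall (fun φ => ?_)))
    simp [hFdef]
  have hsumc : ∀ s : ℝ, Continuous (fun φ : (Fin 4 → ZMod n) → ℝ => ∑ x : Fin 4 → ZMod n,
      (∏ y ∈ (Finset.univ : Finset (Fin 4 → ZMod n)).erase x, (1 + (s : ℂ) * Gx φ y)) • Gx φ x) :=
    fun s => continuous_finsetSum _ (fun x _ =>
      (continuous_finsetProd _ (fun y _ => continuous_const.add (continuous_const.mul (hGxc y)))).smul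
        (hGxc x))
  have hF'_meas : AEStronglyMeasurable (F' 0) volume := (hWc.mul (hsumc 0)).aestronglyMeasurable
  -- the dominating function `C · e^{−S_0/2}`
  set Λc : ℕ := Fintype.card (Fin 4 → ZMod n) with hΛc
  set C : ℝ := Λc * (B * ((1 + ρ) * (1 + B)) ^ Λc) with hCdef
  have hC0 : 0 ≤ C := by positivity
  -- pointwise: `‖W φ‖ ≤ e^{−S_0} (1+ρ)^{|Λ|} e^{Σ g}`
  have hWb : ∀ φ, ‖W φ‖ ≤ Real.exp (-(S 0 φ)) * ((1 + ρ) ^ Λc * Real.exp (∑ x, g φ x)) := by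
    intro φ
    rw [hWdef, norm_mul, Complex.norm_exp]
    simp only [Complex.neg_re, Complex.ofReal_re]
    refine mul_le_mul_of_nonneg_left ?_ (Real.exp_pos _).le
    calc ‖∏ x : Fin 4 → ZMod n, (1 + K (fun i => D φ i x))‖
        = ∏ x : Fin 4 → ZMod n, ‖1 + K (fun i => D φ i x)‖ := norm_prod _ _
      _ ≤ ∏ x : Fin 4 → ZMod n, (1 + ρ) * Real.exp (g φ x) :=
          Finset.prod_le_prod (fun x _ => norm_nonneg _) (fun x _ => by
            have h := norm_one_add_mul_le_weight (c := 1) (by simp) (hg0 φ x) (hKb (fun i => D φ i x))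
            simpa using h)
      _ = (1 + ρ) ^ Λc * Real.exp (∑ x, g φ x) := by
          rw [Finset.prod_mul_distrib, Finset.prod_const, Finset.card_univ, Real.exp_sum]
  -- pointwise: the sum term
  have hsumb : ∀ φ, ∀ s ∈ Metric.ball (0 : ℝ) 1,
      ‖∑ x : Fin 4 → ZMod n, (∏ y ∈ (Finset.univ : Finset (Fin 4 → ZMod n)).erase x,
        (1 + (s : ℂ) * Gx φ y)) • Gx φ x‖ ≤ Λc * (B * (1 + B) ^ Λc * Real.exp (∑ x, g φ x)) := by
    intro φ s hs
    have hs1 : ‖(s : ℂ)‖ ≤ 1 := by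
      have := Metric.mem_ball.mp hs
      rw [dist_zero_right, Real.norm_eq_abs] at this
      rw [Complex.norm_real, Real.norm_eq_abs]; exact this.le
    have hterm : ∀ x, ‖(∏ y ∈ (Finset.univ : Finset (Fin 4 → ZMod n)).erase x,
        (1 + (s : ℂ) * Gx φ y)) • Gx φ x‖ ≤ B * (1 + B) ^ Λc * Real.exp (∑ x, g φ x) := by
      intro x
      have hx : x ∈ (Finset.univ : Finset (Fin 4 → ZMod n)) := Finset.mem_univ x
      rw [norm_smul]
      have h1 : ‖∏ y ∈ (Finset.univ : Finset (Fin 4 → ZMod n)).erase x, (1 + (s : ℂ) * Gx φ y)‖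
          ≤ (1 + B) ^ ((Finset.univ : Finset (Fin 4 → ZMod n)).erase x).card *
            ∏ y ∈ (Finset.univ : Finset (Fin 4 → ZMod n)).erase x, Real.exp (g φ y) := by
        calc ‖∏ y ∈ (Finset.univ : Finset (Fin 4 → ZMod n)).erase x, (1 + (s : ℂ) * Gx φ y)‖
            ≤ ∏ y ∈ (Finset.univ : Finset (Fin 4 → ZMod n)).erase x, ‖1 + (s : ℂ) * Gx φ y‖ :=
              Finset.norm_prod_le _ _
          _ ≤ ∏ y ∈ (Finset.univ : Finset (Fin 4 → ZMod n)).erase x, (1 + B) * Real.exp (g φ y) :=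
              Finset.prod_le_prod (fun y _ => norm_nonneg _)
                (fun y _ => norm_one_add_mul_le_weight hs1 (hg0 φ y) (hGb _))
          _ = (1 + B) ^ ((Finset.univ : Finset (Fin 4 → ZMod n)).erase x).card *
              ∏ y ∈ (Finset.univ : Finset (Fin 4 → ZMod n)).erase x, Real.exp (g φ y) := by
              rw [Finset.prod_mul_distrib, Finset.prod_const]
      have h2 : ‖Gx φ x‖ ≤ B * Real.exp (g φ x) := hGb _
      have hcard : (1 + B) ^ ((Finset.univ : Finset (Fin 4 → ZMod n)).erase x).card ≤ (1 + B) ^ Λc :=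
        pow_le_pow_right₀ (by linarith) (by rw [hΛc, ← Finset.card_univ]; exact Finset.card_erase_le)
      have hprod : (∏ y ∈ (Finset.univ : Finset (Fin 4 → ZMod n)).erase x, Real.exp (g φ y)) * Real.exp (g φ x)
          = Real.exp (∑ y, g φ y) := by
        rw [Finset.prod_erase_mul _ _ hx, Real.exp_sum]
      have hP0 : 0 ≤ ∏ y ∈ (Finset.univ : Finset (Fin 4 → ZMod n)).erase x, Real.exp (g φ y) :=
        Finset.prod_nonneg (fun y _ => (Real.exp_pos _).le)
      calc ‖∏ y ∈ (Finset.univ : Finset (Fin 4 → ZMod n)).erase x, (1 + (s : ℂ) * Gx φ y)‖ * ‖Gx φ x‖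
          ≤ ((1 + B) ^ ((Finset.univ : Finset (Fin 4 → ZMod n)).erase x).card *
              ∏ y ∈ (Finset.univ : Finset (Fin 4 → ZMod n)).erase x, Real.exp (g φ y)) * (B * Real.exp (g φ x)) :=
            mul_le_mul h1 h2 (norm_nonneg _) (by positivity)
        _ = B * (1 + B) ^ ((Finset.univ : Finset (Fin 4 → ZMod n)).erase x).card *
              ((∏ y ∈ (Finset.univ : Finset (Fin 4 → ZMod n)).erase x, Real.exp (g φ y)) * Real.exp (g φ x)) := by
            ring
        _ = B * (1 + B) ^ ((Finset.univ : Finset (Fin 4 → ZMod n)).erase x).card * Real.exp (∑ y, g φ y) := by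
            rw [hprod]
        _ ≤ B * (1 + B) ^ Λc * Real.exp (∑ y, g φ y) := by gcongr
    calc ‖∑ x : Fin 4 → ZMod n, (∏ y ∈ (Finset.univ : Finset (Fin 4 → ZMod n)).erase x,
          (1 + (s : ℂ) * Gx φ y)) • Gx φ x‖
        ≤ ∑ x : Fin 4 → ZMod n, ‖(∏ y ∈ (Finset.univ : Finset (Fin 4 → ZMod n)).erase x,
          (1 + (s : ℂ) * Gx φ y)) • Gx φ x‖ := norm_sum_le _ _
      _ ≤ ∑ _x : Fin 4 → ZMod n, B * (1 + B) ^ Λc * Real.exp (∑ x, g φ x) :=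
          Finset.sum_le_sum (fun x _ => hterm x)
      _ = Λc * (B * (1 + B) ^ Λc * Real.exp (∑ x, g φ x)) := by
          rw [Finset.sum_const, Finset.card_univ, nsmul_eq_mul, hΛc]
  have h_bound : ∀ᵐ φ : (Fin 4 → ZMod n) → ℝ ∂volume, ∀ s ∈ Metric.ball (0 : ℝ) 1,
      ‖F' s φ‖ ≤ C * Real.exp (-(S 0 φ) / 2) := by
    refine Eventually.of_forall (fun φ s hs => ?_)
    have h1 := hWb φ
    have h2 := hsumb φ s hs
    have hE := exp_neg_S_mul_weights_le φ
    calc ‖F' s φ‖ = ‖W φ‖ * ‖∑ x : Fin 4 → ZMod n,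
          (∏ y ∈ (Finset.univ : Finset (Fin 4 → ZMod n)).erase x, (1 + (s : ℂ) * Gx φ y)) • Gx φ x‖ := by
          rw [hF'def, norm_mul]
      _ ≤ (Real.exp (-(S 0 φ)) * ((1 + ρ) ^ Λc * Real.exp (∑ x, g φ x)))
          * (Λc * (B * (1 + B) ^ Λc * Real.exp (∑ x, g φ x))) :=
          mul_le_mul h1 h2 (norm_nonneg _) (by positivity)
      _ = C * (Real.exp (-(S 0 φ)) * (Real.exp (∑ x, g φ x)) ^ 2) := by
          rw [hCdef, mul_pow]; ring
      _ ≤ C * Real.exp (-(S 0 φ) / 2) := mul_le_mul_of_nonneg_left hE hC0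
  have hb_int : Integrable (fun φ : (Fin 4 → ZMod n) → ℝ => C * Real.exp (-(S 0 φ) / 2)) :=
    (integrable_exp_neg_half_S n).const_mul C
  have h_diff : ∀ᵐ φ : (Fin 4 → ZMod n) → ℝ ∂volume, ∀ s ∈ Metric.ball (0 : ℝ) 1,
      HasDerivAt (F · φ) (F' s φ) s := by
    refine Eventually.of_forall (fun φ s _ => ?_)
    have hlin : ∀ x ∈ (Finset.univ : Finset (Fin 4 → ZMod n)),
        HasDerivAt (fun t : ℝ => 1 + (t : ℂ) * Gx φ x) (Gx φ x) s := by
      intro x _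
      have h1 : HasDerivAt (fun t : ℝ => (t : ℂ)) 1 s := (hasDerivAt_id s).ofReal_comp
      have h2 := (h1.mul_const (Gx φ x)).const_add 1
      simpa using h2
    exact (HasDerivAt.fun_finsetProd hlin).const_mul (W φ)
  exact (hasDerivAt_integral_of_dominated_loc_of_deriv_le hball
    (Eventually.of_forall hF_meas) hF_int hF'_meas h_bound hb_int h_diff).2

/-- **(C1), normalised, Gaussian-growth observables**: with `pertZ n K ≠ 0`,
`s ↦ pertZ n (K + sG(1+K)) / pertZ n K` has derivative `|Λ| · onePoint n K G` at `s = 0`. -/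
theorem hasDerivAt_pertZ_linePert_div_growth [NeZero n] {K G : (Fin 4 → ℝ) → ℂ} (hKc : Continuous K)
    {ρ : ℝ} (hρ : 0 ≤ ρ) (hKb : ∀ z : Fin 4 → ℝ, ‖K z‖ ≤ ρ * Real.exp (1 / 8 * ∑ i : Fin 4, (z i) ^ 2))
    (hGc : Continuous G) {B : ℝ} (hB : 0 ≤ B)
    (hGb : ∀ z : Fin 4 → ℝ, ‖G z‖ ≤ B * Real.exp (1 / 8 * ∑ i : Fin 4, (z i) ^ 2)) (hZ : pertZ n K ≠ 0) :
    HasDerivAt (fun s : ℝ => pertZ n (fun z => K z + (s : ℂ) * (G z * (1 + K z))) / pertZ n K)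
      ((Fintype.card (Fin 4 → ZMod n) : ℂ) * onePoint n K G) 0 := by
  have h := (hasDerivAt_pertZ_linePert_growth (n := n) hKc hρ hKb hGc hB hGb).div_const (pertZ n K)
  have hcard : (Fintype.card (Fin 4 → ZMod n) : ℂ) ≠ 0 := Nat.cast_ne_zero.mpr Fintype.card_ne_zero
  refine h.congr_deriv ?_
  unfold onePoint
  field_simp

/-- **(C1)+(C2) for Gaussian-growth observables**: `‖onePoint n K G − onePoint n K' G‖ ≤ M/|Λ|` from the
ratio bound `‖(pertZ(K + sG(1+K))/pertZ(K)) / (pertZ(K' + sG(1+K'))/pertZ(K')) − 1‖ ≤ M|s|` near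
`s = 0`, for continuous `K, K'` with `‖K‖, ‖K'‖ ≤ ρe^{|z|²/8}`, continuous `G` with `‖G‖ ≤ Be^{|z|²/8}`,
`pertZ n K ≠ 0 ≠ pertZ n K'`. -/
theorem norm_onePoint_sub_le_of_ratio_bound_growth [NeZero n] {K K' G : (Fin 4 → ℝ) → ℂ}
    (hKc : Continuous K) (hK'c : Continuous K') {ρ : ℝ} (hρ : 0 ≤ ρ)
    (hKb : ∀ z : Fin 4 → ℝ, ‖K z‖ ≤ ρ * Real.exp (1 / 8 * ∑ i : Fin 4, (z i) ^ 2))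
    (hK'b : ∀ z : Fin 4 → ℝ, ‖K' z‖ ≤ ρ * Real.exp (1 / 8 * ∑ i : Fin 4, (z i) ^ 2))
    (hGc : Continuous G) {B : ℝ} (hB : 0 ≤ B)
    (hGb : ∀ z : Fin 4 → ℝ, ‖G z‖ ≤ B * Real.exp (1 / 8 * ∑ i : Fin 4, (z i) ^ 2))
    (hZ : pertZ n K ≠ 0) (hZ' : pertZ n K' ≠ 0) {M : ℝ}
    (hM : ∀ᶠ s : ℝ in 𝓝 0,
      ‖(pertZ n (fun z => K z + ((s : ℝ) : ℂ) * (G z * (1 + K z))) / pertZ n K) /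
          (pertZ n (fun z => K' z + ((s : ℝ) : ℂ) * (G z * (1 + K' z))) / pertZ n K') - 1‖
        ≤ M * |s|) :
    ‖onePoint n K G - onePoint n K' G‖ ≤ M / Fintype.card (Fin 4 → ZMod n) := by
  have hΦ := hasDerivAt_pertZ_linePert_div_growth (n := n) hKc hρ hKb hGc hB hGb hZ
  have hΨ := hasDerivAt_pertZ_linePert_div_growth (n := n) hK'c hρ hK'b hGc hB hGb hZ'
  have hΦ0 : pertZ n (fun z => K z + ((0 : ℝ) : ℂ) * (G z * (1 + K z))) / pertZ n K = 1 := by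
    simp only [Complex.ofReal_zero, zero_mul, add_zero]
    exact div_self hZ
  have hΨ0 : pertZ n (fun z => K' z + ((0 : ℝ) : ℂ) * (G z * (1 + K' z))) / pertZ n K' = 1 := by
    simp only [Complex.ofReal_zero, zero_mul, add_zero]
    exact div_self hZ'
  have h := norm_sub_le_of_norm_div_sub_one_le hΦ hΨ hΦ0 hΨ0 hM
  have hcard : (0 : ℝ) < Fintype.card (Fin 4 → ZMod n) := Nat.cast_pos.mpr Fintype.card_pos
  rw [← mul_sub, norm_mul, Complex.norm_natCast] at h
  rw [le_div_iff₀ hcard, mul_comm]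
  exact h

end Summit.HubbardSuperconductivity.HubbardSuperconductivity.Theorems.ComplexGFF

end
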